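import Mathlib
import HarnessLib
import Summits.HubbardSuperconductivity.HubbardSuperconductivity.Theorems.KLProgrammeKLRegimeEnginePairLadderTowerComposeFwd

/-!
# Route `KLProgramme` — crux K3, ENGINE child (gen 6 stmt-…-20236 `KLRegimeEngineV16`; gen 7-flow `KLRegimeEngineV17F`), stub `stub_engine_step_values`,
# conjunct (E2) at `1 ≤ n`: the forward tower composition on an ARBITRARY truncation set — `kltc_compose_fwd_on`

Cell gate-hubbard-kl, seat hubbard-kl-k3c1-p1 (g7), technique «composed-map remainder propagation».  `kltc_pairClass_compose_fwd` (p518064) hard-wires the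
plain arrays `klPairArray … K j Qm` (truncated on the FRAME ball `klBall L μ K`) and reads on the same ball.  The gen-7-flow slot (E2-F) (`PairLadderStepAtV17F`,
`…SplitSlotsV17F` p524744; rev 2 with k3c2-p2's cure 1 `klPairArrayF`, T2-2 11:02:58Z) resums an array truncated on the BARE ball `klBall L μ 0` of the amplitude at
frame `K_{n−1}` and reads the amplitude at frame `K_n` on the same bare ball.  This file states the composition once for ANY finite truncation set `B` and ANY two
matrices `C₀, C₁` vanishing off `B²` — so the V10 door (B = frame ball, C_j = klPairArray K j) and the V17F door (B = bare ball, C_j = klPairArrayF j) are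
both five-line instances:

* **`kltc_compose_fwd_on`** — `C₀, C₁, X, Y` vanish off `B²`, `|C₀| ≤ m`; straddles `(1 − diag b′C₀)M′ = 1`, `‖X − C₀M′‖ ≤ R′ ≤ r′` on `B²`, Wick step
  `(1 + diag w₁X)N = 1`, `‖Y − XN‖ ≤ E_a` on `B²`, `(1 − diag bC₁)M₀ = 1`, `‖Y − C₁M₀‖ ≤ E_R ≤ e_R` on `B²`; majorants `E₁ ≥ E_a + FT_{|w₁|}(R′)`, `E₁ ≤ e₁`,
  `E₂ ≥ E_R + E₁`; smallness ×3 ⟹ `∃ N₃` two-sided inverse of `1 + diag(w₁ + b − b′)·C₀` with `‖C₁(k,k′) − (C₀N₃)(k,k′)‖ ≤ FT_{|b|}(E₂)(k,k′)` on `B²`.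

Exact algebra over `kltc_tower_compose_fwd` (p496062); nothing about the model is asserted.  0 kit.
-/

noncomputable section

namespace Summit.HubbardSuperconductivity.HubbardSuperconductivity.Theorems.KLRegimeSplit

set_option linter.dupNamespace false -- summit = problem name (single-conjunct summit), D-0017

open Finset Matrix

section Compose

variable {S : Type*} [Fintype S] [DecidableEq S] [Nonempty S]

/-- **Forward tower composition on an arbitrary truncation set `B`.**  See the module docstring. -/
theorem kltc_compose_fwd_on (B : Finset S) (C₀ C₁ X Y M' N M₀ : Matrix S S ℂ) (b' w₁ b : S → ℝ) (R' Ea ER E₁ E₂ : S → S → ℝ)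
    {m r' eR e₁ : ℝ} (hm : 0 ≤ m) (hr' : 0 ≤ r') (heR : 0 ≤ eR) (he₁ : 0 ≤ e₁) (hC₀ : ∀ s t, ‖C₀ s t‖ ≤ m)
    (hC₀0 : ∀ x y, ¬(x ∈ B ∧ y ∈ B) → C₀ x y = 0) (hC₁0 : ∀ x y, ¬(x ∈ B ∧ y ∈ B) → C₁ x y = 0)
    (hX0 : ∀ x y, ¬(x ∈ B ∧ y ∈ B) → X x y = 0) (hY0 : ∀ x y, ¬(x ∈ B ∧ y ∈ B) → Y x y = 0)
    (hR'0 : ∀ x y, 0 ≤ R' x y) (hEa0 : ∀ x y, 0 ≤ Ea x y) (hER0 : ∀ x y, 0 ≤ ER x y)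
    (hM' : (1 - diagonal (fun p => (b' p : ℂ)) * C₀) * M' = 1)
    (hR' : ∀ k ∈ B, ∀ k' ∈ B, ‖X k k' - (C₀ * M') k k'‖ ≤ R' k k') (hR'e : ∀ x y, R' x y ≤ r')
    (hN : (1 + diagonal (fun p => (w₁ p : ℂ)) * X) * N = 1)
    (hEa : ∀ k ∈ B, ∀ k' ∈ B, ‖Y k k' - (X * N) k k'‖ ≤ Ea k k')
    (hM₀ : (1 - diagonal (fun p => (b p : ℂ)) * C₁) * M₀ = 1)
    (hER : ∀ k ∈ B, ∀ k' ∈ B, ‖Y k k' - (C₁ * M₀) k k'‖ ≤ ER k k') (hERe : ∀ x y, ER x y ≤ eR)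
    (hE₁ : ∀ x y, Ea x y + (R' x y + 3 / 2 * (3 / 2 * m) * ∑ t, R' x t * |w₁ t| + 3 / 2 * (3 / 2 * m + r') * ∑ a, |w₁ a| * R' a y +
        9 / 4 * (3 / 2 * m + r') * (3 / 2 * m) * ∑ a, ∑ t, |w₁ a| * R' a t * |w₁ t|) ≤ E₁ x y)
    (hE₁e : ∀ x y, E₁ x y ≤ e₁) (hE₂ : ∀ x y, ER x y + E₁ x y ≤ E₂ x y)
    (hsm₀ : m * ∑ a, |b' a| ≤ 1 / 3) (hsm₁ : (3 / 2 * m + r') * ∑ a, |w₁ a| ≤ 1 / 3)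
    (hsm₂ : (9 / 4 * m + e₁ + eR) * ∑ a, |b a| ≤ 1 / 3) :
    ∃ N₃ : Matrix S S ℂ,
      (1 + diagonal (fun p => ((w₁ p + b p - b' p : ℝ) : ℂ)) * C₀) * N₃ = 1 ∧
      N₃ * (1 + diagonal (fun p => ((w₁ p + b p - b' p : ℝ) : ℂ)) * C₀) = 1 ∧
      ∀ k ∈ B, ∀ k' ∈ B,
        ‖C₁ k k' - (C₀ * N₃) k k'‖ ≤
          E₂ k k' + 3 / 2 * (9 / 4 * m) * ∑ t, E₂ k t * |b t| + 3 / 2 * (9 / 4 * m + e₁ + eR) * ∑ a, |b a| * E₂ a k' +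
            9 / 4 * (9 / 4 * m + e₁ + eR) * (9 / 4 * m) * ∑ a, ∑ t, |b a| * E₂ a t * |b t| := by
  -- vanishing of the resummed arrays off `B²`
  have hM'alt : (1 + (-diagonal (fun p => (b' p : ℂ))) * C₀) * M' = 1 := by
    rw [neg_mul, ← sub_eq_add_neg]; exact hM'
  have hM₀alt : (1 + (-diagonal (fun p => (b p : ℂ))) * C₁) * M₀ = 1 := by
    rw [neg_mul, ← sub_eq_add_neg]; exact hM₀
  have hC₀M'0 : ∀ x y, ¬(x ∈ B ∧ y ∈ B) → (C₀ * M') x y = 0 := fun x y hxy =>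
    kltc_mul_rightInv_apply_eq_zero C₀ _ M' B hM'alt hC₀0 hxy
  have hXN0 : ∀ x y, ¬(x ∈ B ∧ y ∈ B) → (X * N) x y = 0 := fun x y hxy =>
    kltc_mul_rightInv_apply_eq_zero X _ N B hN hX0 hxy
  have hC₁M₀0 : ∀ x y, ¬(x ∈ B ∧ y ∈ B) → (C₁ * M₀) x y = 0 := fun x y hxy =>
    kltc_mul_rightInv_apply_eq_zero C₁ _ M₀ B hM₀alt hC₁0 hxy
  -- global error bounds
  have gR' : ∀ x y, ‖X x y - (C₀ * M') x y‖ ≤ R' x y := by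
    intro x y
    by_cases hxy : x ∈ B ∧ y ∈ B
    · exact hR' x hxy.1 y hxy.2
    · rw [hX0 x y hxy, hC₀M'0 x y hxy, sub_zero, norm_zero]; exact hR'0 x y
  have gEa : ∀ x y, ‖Y x y - (X * N) x y‖ ≤ Ea x y := by
    intro x y
    by_cases hxy : x ∈ B ∧ y ∈ B
    · exact hEa x hxy.1 y hxy.2
    · rw [hY0 x y hxy, hXN0 x y hxy, sub_zero, norm_zero]; exact hEa0 x y
  have gER : ∀ x y, ‖Y x y - (C₁ * M₀) x y‖ ≤ ER x y := by
    intro x y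
    by_cases hxy : x ∈ B ∧ y ∈ B
    · exact hER x hxy.1 y hxy.2
    · rw [hY0 x y hxy, hC₁M₀0 x y hxy, sub_zero, norm_zero]; exact hER0 x y
  -- norms of the real weights
  have hτ : ∀ a, ‖(b' a : ℂ)‖ ≤ |b' a| := fun a => by rw [Complex.norm_real, Real.norm_eq_abs]
  have hρ : ∀ a, ‖(w₁ a : ℂ)‖ ≤ |w₁ a| := fun a => by rw [Complex.norm_real, Real.norm_eq_abs]
  have hσ : ∀ a, ‖(b a : ℂ)‖ ≤ |b a| := fun a => by rw [Complex.norm_real, Real.norm_eq_abs]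
  obtain ⟨N₃, hN₃1, hN₃2, hbd⟩ := kltc_tower_compose_fwd C₀ C₁ X Y M' N M₀ (fun p => (b' p : ℂ)) (fun p => (w₁ p : ℂ))
    (fun p => (b p : ℂ)) (fun a => |b' a|) (fun a => |w₁ a|) (fun a => |b a|) R' Ea ER E₁ E₂ hm hr' heR he₁ hC₀ hτ hρ hσ hM' gR'
    hR'e hN gEa hM₀ gER hERe hE₁ hE₁e hE₂ hsm₀ hsm₁ hsm₂
  have hfun : (fun p => ((w₁ p + b p - b' p : ℝ) : ℂ)) = fun a => (w₁ a : ℂ) + (b a : ℂ) - (b' a : ℂ) := by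
    funext p; push_cast; ring
  exact ⟨N₃, by rw [hfun]; exact hN₃1, by rw [hfun]; exact hN₃2, fun k _ k' _ => hbd k k'⟩

end Compose

end Summit.HubbardSuperconductivity.HubbardSuperconductivity.Theorems.KLRegimeSplit

end
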